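import Summits.RiemannHypothesis.RiemannHypothesis.Theorems.WeilColumnThetaTailNorms
import HarnessLib

/-!
# THETA kernel certificate, analytic layer D3 (sequel): the ODD cut theta tail `T⁻(x) = T(x) − T(−x)` (RH-FREE)

Cell `rh-explicit`, WEIL column, seat handoff-prove-2 gen12; typing lane of `ThetaCertificateSound`
(THETA-KERNEL-BLUEPRINT v1.3 §3(3d)/(P_R); THETA-CERT-cc6 §D3).  Upper clauses of truncated Weil forms only;
nothing here bears on the truth of RH.

Setting of `WeilColumnThetaTailNorms` (D1/D2 majorants as HYPOTHESES; `T := expProfile Θ·(1 − χ)`, cut at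
`x₁ = log u₁`).  For `x₁ < 0` the tail and its reflection have DISJOINT supports, so the odd extension doubles both
norms: **`A := ∫‖T⁻‖² ≤ 2M²u₁/(2m+1)`** and **`B := ∫‖(T⁻)′‖² ≤ 2((½+L)M√(u₁/(2m+1)) + M₁√(u₁/(2m−1)))²`** —
the `Ahi`/`Bhi` lets of cc-s2-1's `ThetaTier1Check.check` as real inequalities (`L = m/η′`), ready for
`WeilColumnThetaArch.re_weilArchTerm_weilConv_weilReflect_le_thetaCheck` (D7, p418753).  No measurability of `Θ`
is assumed.
-/

noncomputable section

set_option linter.dupNamespace false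

open Complex Set MeasureTheory Filter
open scoped Real Topology

namespace Summit.RiemannHypothesis.RiemannHypothesis.Theorems.WeilColumn.ThetaTail

open Literature.NumberTheory.LFunctions
open Summit.RiemannHypothesis.RiemannHypothesis.Theorems.WeilColumn.ThetaMellin

variable {Θ Θ' : ℝ → ℂ} {χ χ' : ℝ → ℝ} {M M₁ L u₁ x₁ : ℝ} {m : ℕ}

/-! ## §4 The odd extension `T⁻(x) = T(x) − T(−x)` for `x₁ < 0`: both norms double -/

/-- For `x₁ < 0` the tail and its reflection have disjoint supports: at every `x` one of `T x`, `T (−x)` vanishes, so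
`‖T x − T(−x)‖² ≤ E(x) + E(−x)` for any pointwise majorant `E ≥ 0` of `‖T‖²` that also vanishes beyond `x₁`… here
with the explicit exponential majorant. **`A := ∫‖T⁻‖² ≤ 2M²u₁/(2m+1)`.** [THETA-CERT-cc6 §D3] -/
theorem integral_norm_sq_oddTail_le (hx₁ : x₁ < 0) (hu₁ : u₁ = Real.exp x₁)
    (hM : ∀ u ∈ Ioc (0 : ℝ) u₁, ‖Θ u‖ ≤ M * (u / u₁) ^ m)
    (hχ01 : ∀ x, χ x ∈ Icc (0 : ℝ) 1) (hχ1 : ∀ x, x₁ ≤ x → χ x = 1) :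
    ∫ x : ℝ, ‖expProfile Θ x * (((1 - χ x : ℝ)) : ℂ) - expProfile Θ (-x) * (((1 - χ (-x) : ℝ)) : ℂ)‖ ^ 2 ≤
      2 * (M ^ 2 * u₁ / (2 * m + 1)) := by
  set T : ℝ → ℂ := fun x ↦ expProfile Θ x * (((1 - χ x : ℝ)) : ℂ) with hT
  set env : ℝ → ℝ := (Iic x₁).indicator fun x ↦ M ^ 2 * (Real.exp x * (Real.exp x / u₁) ^ (2 * m)) with henv
  have hint : Integrable env := by
    rw [henv]
    refine IntegrableOn.integrable_indicator ?_ measurableSet_Iic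
    exact (integrableOn_exp_mul_pow_Iic hu₁ (2 * m)).const_mul _
  have henv0 : ∀ x, 0 ≤ env x := by
    intro x; rw [henv]
    refine Set.indicator_nonneg (fun y _ ↦ ?_) x
    have hu0 : 0 < u₁ := by rw [hu₁]; exact Real.exp_pos _
    positivity
  -- the one-sided bound `‖T x‖² ≤ env x` (everywhere)
  have hone : ∀ x : ℝ, ‖T x‖ ^ 2 ≤ env x := by
    intro x
    by_cases hx : x ≤ x₁
    · rw [henv, indicator_of_mem (show x ∈ Iic x₁ from hx)]
      have h := norm_tail_le hu₁ hM hχ01 hx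
      calc ‖T x‖ ^ 2 ≤ (M * Real.exp (x / 2) * (Real.exp x / u₁) ^ m) ^ 2 := pow_le_pow_left₀ (norm_nonneg _) h 2
        _ = M ^ 2 * (Real.exp x * (Real.exp x / u₁) ^ (2 * m)) := by
            rw [show Real.exp x = Real.exp (x / 2) ^ 2 by rw [← Real.exp_nat_mul]; ring_nf]
            ring
    · have : T x = 0 := tail_eq_zero hχ1 (le_of_not_ge hx)
      rw [this, norm_zero]
      simpa using henv0 x
  -- disjointness: `‖T x − T(−x)‖² ≤ env x + env (−x)`
  have hpt : ∀ x : ℝ, ‖T x - T (-x)‖ ^ 2 ≤ env x + env (-x) := by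
    intro x
    by_cases hx : x₁ ≤ x
    · have : T x = 0 := tail_eq_zero hχ1 hx
      rw [this, zero_sub, norm_neg]
      linarith [hone (-x), henv0 x]
    · have hx' : x₁ ≤ -x := by linarith [lt_of_not_ge hx]
      have : T (-x) = 0 := tail_eq_zero hχ1 hx'
      rw [this, sub_zero]
      linarith [hone x, henv0 (-x)]
  have hint2 : Integrable fun x ↦ env x + env (-x) := hint.add (hint.comp_neg)
  calc ∫ x : ℝ, ‖T x - T (-x)‖ ^ 2 ≤ ∫ x, (env x + env (-x)) :=
        integral_mono_of_nonneg (Eventually.of_forall fun x ↦ by positivity) hint2 (Eventually.of_forall hpt)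
    _ = 2 * ∫ x, env x := by
        rw [integral_add hint hint.comp_neg, integral_neg_eq_self env volume]; ring
    _ ≤ 2 * (M ^ 2 * u₁ / (2 * m + 1)) := by
        refine mul_le_mul_of_nonneg_left (le_of_eq ?_) zero_le_two
        rw [henv, integral_indicator measurableSet_Iic, integral_const_mul, setIntegral_exp_mul_pow_Iic hu₁]
        push_cast
        ring

/-- The odd extension is differentiable with `(T⁻)′(x) = T′(x) + T′(−x)`. -/
theorem hasDerivAt_oddTail (hΘ' : ∀ u : ℝ, 0 < u → HasDerivAt Θ (Θ' u) u) (hχ' : ∀ x, HasDerivAt χ (χ' x) x)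
    (x : ℝ) :
    HasDerivAt (fun x : ℝ ↦ expProfile Θ x * (((1 - χ x : ℝ)) : ℂ) - expProfile Θ (-x) * (((1 - χ (-x) : ℝ)) : ℂ))
      (((Real.exp (x / 2) : ℂ) * ((1 / 2 : ℂ) * Θ (Real.exp x) + (Real.exp x : ℂ) * Θ' (Real.exp x)) *
          (((1 - χ x : ℝ)) : ℂ) - (Real.exp (x / 2) : ℂ) * Θ (Real.exp x) * (χ' x : ℂ)) +
        ((Real.exp (-x / 2) : ℂ) * ((1 / 2 : ℂ) * Θ (Real.exp (-x)) + (Real.exp (-x) : ℂ) * Θ' (Real.exp (-x))) *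
          (((1 - χ (-x) : ℝ)) : ℂ) - (Real.exp (-x / 2) : ℂ) * Θ (Real.exp (-x)) * (χ' (-x) : ℂ))) x := by
  have h1 := hasDerivAt_tail hΘ' hχ' x
  have h2 := (hasDerivAt_tail hΘ' hχ' (-x)).scomp x (hasDerivAt_neg x)
  have h := h1.fun_sub h2
  simp only [Function.comp_def, neg_one_smul, sub_neg_eq_add] at h
  exact h

/-- **`B := ∫‖(T⁻)′‖² ≤ 2·[(½+L)²M²u₁/(2m+1) + 2(½+L)MM₁u₁/(2m) + M₁²u₁/(2m−1)]`** for `x₁ < 0`, `m ≥ 1`. [THETA-CERT-cc6 §D3] -/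
theorem integral_norm_sq_deriv_oddTail_le (hm : 1 ≤ m) (hx₁ : x₁ < 0) (hu₁ : u₁ = Real.exp x₁)
    (hM : ∀ u ∈ Ioc (0 : ℝ) u₁, ‖Θ u‖ ≤ M * (u / u₁) ^ m)
    (hM₁ : ∀ u ∈ Ioc (0 : ℝ) u₁, ‖(u : ℂ) * Θ' u‖ ≤ M₁ * (u / u₁) ^ (m - 1))
    (hχ01 : ∀ x, χ x ∈ Icc (0 : ℝ) 1) (hχ1 : ∀ x, x₁ ≤ x → χ x = 1) (hχ' : ∀ x, HasDerivAt χ (χ' x) x)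
    (hL : ∀ x, |χ' x| ≤ L) :
    ∫ x : ℝ, ‖((Real.exp (x / 2) : ℂ) * ((1 / 2 : ℂ) * Θ (Real.exp x) + (Real.exp x : ℂ) * Θ' (Real.exp x)) *
          (((1 - χ x : ℝ)) : ℂ) - (Real.exp (x / 2) : ℂ) * Θ (Real.exp x) * (χ' x : ℂ)) +
        ((Real.exp (-x / 2) : ℂ) * ((1 / 2 : ℂ) * Θ (Real.exp (-x)) + (Real.exp (-x) : ℂ) * Θ' (Real.exp (-x))) *
          (((1 - χ (-x) : ℝ)) : ℂ) - (Real.exp (-x / 2) : ℂ) * Θ (Real.exp (-x)) * (χ' (-x) : ℂ))‖ ^ 2 ≤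
      2 * (((1 / 2 + L) * M) ^ 2 * (u₁ / (2 * m + 1)) + 2 * ((1 / 2 + L) * M) * M₁ * (u₁ / (2 * m)) +
        M₁ ^ 2 * (u₁ / (2 * m - 1))) := by
  set D : ℝ → ℂ := fun x ↦ (Real.exp (x / 2) : ℂ) * ((1 / 2 : ℂ) * Θ (Real.exp x) + (Real.exp x : ℂ) * Θ' (Real.exp x)) *
          (((1 - χ x : ℝ)) : ℂ) - (Real.exp (x / 2) : ℂ) * Θ (Real.exp x) * (χ' x : ℂ) with hD
  have hDneg : ∀ x : ℝ, (Real.exp (-x / 2) : ℂ) * ((1 / 2 : ℂ) * Θ (Real.exp (-x)) +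
      (Real.exp (-x) : ℂ) * Θ' (Real.exp (-x))) * (((1 - χ (-x) : ℝ)) : ℂ) -
        (Real.exp (-x / 2) : ℂ) * Θ (Real.exp (-x)) * (χ' (-x) : ℂ) = D (-x) := by
    intro x; simp only [hD, neg_div]
  simp_rw [hDneg]
  change ∫ x : ℝ, ‖D x + D (-x)‖ ^ 2 ≤ _
  set a : ℝ := (1 / 2 + L) * M with ha
  set env : ℝ → ℝ := (Iic x₁).indicator fun x ↦
    a ^ 2 * (Real.exp x * (Real.exp x / u₁) ^ (2 * m)) + 2 * a * M₁ * (Real.exp x * (Real.exp x / u₁) ^ (2 * m - 1)) +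
      M₁ ^ 2 * (Real.exp x * (Real.exp x / u₁) ^ (2 * m - 2)) with henv
  have hu0 : 0 < u₁ := by rw [hu₁]; exact Real.exp_pos _
  have hM0 : 0 ≤ M := by
    have h := hM u₁ ⟨hu0, le_rfl⟩
    rw [div_self hu0.ne', one_pow, mul_one] at h
    exact (norm_nonneg _).trans h
  have hM₁0 : 0 ≤ M₁ := by
    have h := hM₁ u₁ ⟨hu0, le_rfl⟩
    rw [div_self hu0.ne', one_pow, mul_one] at h
    exact (norm_nonneg _).trans h
  have hL0 : 0 ≤ L := (abs_nonneg _).trans (hL 0)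
  have ha0 : 0 ≤ a := by rw [ha]; positivity
  have hint : Integrable env := by
    rw [henv]
    refine IntegrableOn.integrable_indicator ?_ measurableSet_Iic
    exact (((integrableOn_exp_mul_pow_Iic hu₁ (2 * m)).const_mul _).add
      ((integrableOn_exp_mul_pow_Iic hu₁ (2 * m - 1)).const_mul _)).add
      ((integrableOn_exp_mul_pow_Iic hu₁ (2 * m - 2)).const_mul _)
  have henv0 : ∀ x, 0 ≤ env x := by
    intro x; rw [henv]
    exact Set.indicator_nonneg (fun y _ ↦ by positivity) x
  have hsq : ∀ x : ℝ, Real.exp (x / 2) * Real.exp (x / 2) = Real.exp x := by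
    intro x; rw [← Real.exp_add]; ring_nf
  have hp1 : m + m = 2 * m := by ring
  have hp2 : m + (m - 1) = 2 * m - 1 := by omega
  have hp3 : (m - 1) + (m - 1) = 2 * m - 2 := by omega
  have hone : ∀ x : ℝ, ‖D x‖ ^ 2 ≤ env x := by
    intro x
    by_cases hx : x ≤ x₁
    · rw [henv, indicator_of_mem (show x ∈ Iic x₁ from hx)]
      have h := norm_deriv_tail_le hu₁ hM hM₁ hχ01 hL hx
      refine (pow_le_pow_left₀ (norm_nonneg _) h 2).trans (le_of_eq ?_)
      set r : ℝ := Real.exp x / u₁ with hr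
      have e1 : r ^ m * r ^ m = r ^ (2 * m) := by rw [← pow_add, hp1]
      have e2 : r ^ m * r ^ (m - 1) = r ^ (2 * m - 1) := by rw [← pow_add, hp2]
      have e3 : r ^ (m - 1) * r ^ (m - 1) = r ^ (2 * m - 2) := by rw [← pow_add, hp3]
      rw [ha]
      calc ((1 / 2 + L) * M * Real.exp (x / 2) * r ^ m + M₁ * Real.exp (x / 2) * r ^ (m - 1)) ^ 2
          = ((1 / 2 + L) * M) ^ 2 * ((Real.exp (x / 2) * Real.exp (x / 2)) * (r ^ m * r ^ m)) +
              2 * ((1 / 2 + L) * M) * M₁ * ((Real.exp (x / 2) * Real.exp (x / 2)) * (r ^ m * r ^ (m - 1))) +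
              M₁ ^ 2 * ((Real.exp (x / 2) * Real.exp (x / 2)) * (r ^ (m - 1) * r ^ (m - 1))) := by ring
        _ = _ := by rw [hsq, e1, e2, e3]
    · have hx' : x₁ < x := lt_of_not_ge hx
      have : D x = 0 := deriv_tail_eq_zero hχ1 hχ' hx'
      rw [this, norm_zero]
      simpa using henv0 x
  have hpt : ∀ x : ℝ, ‖D x + D (-x)‖ ^ 2 ≤ env x + env (-x) := by
    intro x
    by_cases hx : x₁ < x
    · have : D x = 0 := deriv_tail_eq_zero hχ1 hχ' hx
      rw [this, zero_add]
      linarith [hone (-x), henv0 x]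
    · have hx' : x₁ < -x := by linarith [le_of_not_gt hx]
      have : D (-x) = 0 := deriv_tail_eq_zero hχ1 hχ' hx'
      rw [this, add_zero]
      linarith [hone x, henv0 (-x)]
  have hint2 : Integrable fun x ↦ env x + env (-x) := hint.add (hint.comp_neg)
  have hm1 : ((2 * m - 1 : ℕ) : ℝ) = 2 * m - 1 := by
    rw [Nat.cast_sub (by omega)]; push_cast; ring
  have hm2 : ((2 * m - 2 : ℕ) : ℝ) = 2 * m - 2 := by
    rw [Nat.cast_sub (by omega)]; push_cast; ring
  calc ∫ x : ℝ, ‖D x + D (-x)‖ ^ 2 ≤ ∫ x, (env x + env (-x)) :=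
        integral_mono_of_nonneg (Eventually.of_forall fun x ↦ by positivity) hint2 (Eventually.of_forall hpt)
    _ = 2 * ∫ x, env x := by
        rw [integral_add hint hint.comp_neg, integral_neg_eq_self env volume]; ring
    _ = 2 * (a ^ 2 * (u₁ / (2 * m + 1)) + 2 * a * M₁ * (u₁ / (2 * m)) + M₁ ^ 2 * (u₁ / (2 * m - 1))) := by
        congr 1
        rw [henv, integral_indicator measurableSet_Iic]
        have i1 := (integrableOn_exp_mul_pow_Iic hu₁ (2 * m)).const_mul (a ^ 2)
        have i2 := (integrableOn_exp_mul_pow_Iic hu₁ (2 * m - 1)).const_mul (2 * a * M₁)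
        have i3 := (integrableOn_exp_mul_pow_Iic hu₁ (2 * m - 2)).const_mul (M₁ ^ 2)
        have i12 : IntegrableOn (fun x : ℝ ↦ a ^ 2 * (Real.exp x * (Real.exp x / u₁) ^ (2 * m)) +
            2 * a * M₁ * (Real.exp x * (Real.exp x / u₁) ^ (2 * m - 1))) (Iic x₁) := i1.add i2
        rw [integral_add i12 i3, integral_add i1 i2, integral_const_mul, integral_const_mul,
          integral_const_mul, setIntegral_exp_mul_pow_Iic hu₁, setIntegral_exp_mul_pow_Iic hu₁,
          setIntegral_exp_mul_pow_Iic hu₁, hm1, hm2]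
        push_cast
        ring_nf

/-- **D3 IN THE CHECKER'S CURRENCY** (`ThetaTier1Check.check`: `Ahi := 2·M²·u₁/(2m+1)`,
`Bin := (½ + m/η′)·M·√(u₁/(2m+1)) + M₁·√(u₁/(2m−1))`, `Bhi := 2·Bin²`): for `x₁ < 0`, `m ≥ 1`, with `L` the cut's
Lipschitz constant (`m/η′`), `A = ∫‖T⁻‖² ≤ 2M²u₁/(2m+1)` and
`B = ∫‖(T⁻)′‖² ≤ 2((½+L)M√(u₁/(2m+1)) + M₁√(u₁/(2m−1)))²`.  RH-FREE bookkeeping. [THETA-CERT-cc6 §D3] -/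
theorem integral_norm_sq_deriv_oddTail_le_thetaCheck (hm : 1 ≤ m) (hx₁ : x₁ < 0) (hu₁ : u₁ = Real.exp x₁)
    (hM : ∀ u ∈ Ioc (0 : ℝ) u₁, ‖Θ u‖ ≤ M * (u / u₁) ^ m)
    (hM₁ : ∀ u ∈ Ioc (0 : ℝ) u₁, ‖(u : ℂ) * Θ' u‖ ≤ M₁ * (u / u₁) ^ (m - 1))
    (hχ01 : ∀ x, χ x ∈ Icc (0 : ℝ) 1) (hχ1 : ∀ x, x₁ ≤ x → χ x = 1) (hχ' : ∀ x, HasDerivAt χ (χ' x) x)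
    (hL : ∀ x, |χ' x| ≤ L) :
    ∫ x : ℝ, ‖((Real.exp (x / 2) : ℂ) * ((1 / 2 : ℂ) * Θ (Real.exp x) + (Real.exp x : ℂ) * Θ' (Real.exp x)) *
          (((1 - χ x : ℝ)) : ℂ) - (Real.exp (x / 2) : ℂ) * Θ (Real.exp x) * (χ' x : ℂ)) +
        ((Real.exp (-x / 2) : ℂ) * ((1 / 2 : ℂ) * Θ (Real.exp (-x)) + (Real.exp (-x) : ℂ) * Θ' (Real.exp (-x))) *
          (((1 - χ (-x) : ℝ)) : ℂ) - (Real.exp (-x / 2) : ℂ) * Θ (Real.exp (-x)) * (χ' (-x) : ℂ))‖ ^ 2 ≤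
      2 * ((1 / 2 + L) * M * Real.sqrt (u₁ / (2 * m + 1)) + M₁ * Real.sqrt (u₁ / (2 * m - 1))) ^ 2 := by
  have hu0 : 0 < u₁ := by rw [hu₁]; exact Real.exp_pos _
  have hM0 : 0 ≤ M := by
    have h := hM u₁ ⟨hu0, le_rfl⟩
    rw [div_self hu0.ne', one_pow, mul_one] at h
    exact (norm_nonneg _).trans h
  have hM₁0 : 0 ≤ M₁ := by
    have h := hM₁ u₁ ⟨hu0, le_rfl⟩
    rw [div_self hu0.ne', one_pow, mul_one] at h
    exact (norm_nonneg _).trans h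
  have hL0 : 0 ≤ L := (abs_nonneg _).trans (hL 0)
  have h := integral_norm_sq_deriv_oddTail_le hm hx₁ hu₁ hM hM₁ hχ01 hχ1 hχ' hL
  have h2 := sq_envelope_le_minkowski (L := L) hm hM0 hM₁0 (by positivity) hu0.le
  linarith

end Summit.RiemannHypothesis.RiemannHypothesis.Theorems.WeilColumn.ThetaTail

end
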